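import Summits.Ventures.Crystal3D.Theorems.StickyWulffConstantPolycrystalWulffBoundRungTwinFreeThreeClassesCore
import Summits.Ventures.Crystal3D.Theorems.StickyWulffConstantPolycrystalWulffBoundRungTwinFreeTwoClassesOverlap
import Summits.Ventures.Crystal3D.Theorems.StickyWulffConstantPolycrystalWulffBoundRungDominantTwinFree

/-!
# `PolycrystalWulffBound`, line `PolyDensity`: twin-free textures with at most THREE lattice classes

Route `StickyWulffConstant` of the venture `Summits/Ventures/Crystal3D`, crux `PolycrystalWulffBound`
(item `stmt-Ventures-19482`), second prover lane (poly-p2, gen 4).  The middle-band rung for three classes: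
`rung_twinFree_threeClasses_of_overlap` — a twin-free polyhedral texture whose grains carry AT MOST THREE
lattices (pigeonhole form on four grains) satisfies the polycrystal Wulff bound, GIVEN the pair-overlap
constant `∀ R, 27.8 ≤ |W(1) ∩ W(R)|` (computational hypothesis CH-P1′, certified by kit jobs, see
`…WulffOverlapHyps`).  Case split: a dominant class (`rung_dominantTwinFree`, threshold `17/20`); at most
two classes (`rung_twinFree_twoClasses_of_overlap`, constant `27.5 ≤ 27.8`); otherwise three pairwise
distinct lattices, sorted by class volume, and `threeClass_core` (the typed certificate `cert3_k278`).
WHAT THIS IS NOT: four or more classes (the LP needs the m-class certificate); F-C1 not moved.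
-/

noncomputable section

open scoped BigOperators InnerProductSpace ENNReal
open MeasureTheory Filter

namespace Summit.Ventures.Crystal3D.Cruxes.PolycrystalWulffBound.PolyDensity

open Summit.Ventures.Crystal3D.Theorems

/-- **Middle band, three classes.**  Twin-free polyhedral textures with at most three lattice classes obey
the polycrystal Wulff bound, given `∀ R, 27.8 ≤ |W(1) ∩ W(R)|`. -/
theorem rung_twinFree_threeClasses_of_overlap :
    let Λ : Set (EuclideanSpace ℝ (Fin 3)) := Literature.MathematicalPhysics.StatisticalMechanics.fccStacking 1 (Real.sqrt (2 / 3));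
    let Brl : (ℤ → ℤ) → Set (EuclideanSpace ℝ (Fin 3)) := Literature.MathematicalPhysics.StatisticalMechanics.barlowStacking 1 (Real.sqrt (2 / 3));
    let Ax : EuclideanSpace ℝ (Fin 3) → (EuclideanSpace ℝ (Fin 3) ≃ₗᵢ[ℝ] EuclideanSpace ℝ (Fin 3)) → (EuclideanSpace ℝ (Fin 3) ≃ₗᵢ[ℝ] EuclideanSpace ℝ (Fin 3)) → Prop := fun m A B => ∃ (L : EuclideanSpace ℝ (Fin 3) ≃ₗᵢ[ℝ] EuclideanSpace ℝ (Fin 3)) (s₁ s₂ : EuclideanSpace ℝ (Fin 3)) (σ σ' : ℤ → ℤ), Literature.MathematicalPhysics.StatisticalMechanics.IsHaggSeq σ ∧ Literature.MathematicalPhysics.StatisticalMechanics.IsHaggSeq σ' ∧ L (EuclideanSpace.single (2 : Fin 3) (1 : ℝ)) = m ∧ A '' Λ ⊆ (fun q => L q + s₁) '' Brl σ ∧ B '' Λ ⊆ (fun q => L q + s₂) '' Brl σ';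
    let CoAx : (EuclideanSpace ℝ (Fin 3) ≃ₗᵢ[ℝ] EuclideanSpace ℝ (Fin 3)) → (EuclideanSpace ℝ (Fin 3) ≃ₗᵢ[ℝ] EuclideanSpace ℝ (Fin 3)) → Prop := fun A B => ∃ m, Ax m A B;
    let Φ : EuclideanSpace ℝ (Fin 3) → ℝ := fun ν => Real.sqrt 2 / 4 * ∑ᶠ w ∈ {w ∈ Λ | ‖w‖ = 1}, |⟪w, ν⟫_ℝ|;
    let Per : Set (EuclideanSpace ℝ (Fin 3)) → Set (EuclideanSpace ℝ (Fin 3)) → ℝ := fun K S => (⨆ (ξ : EuclideanSpace ℝ (Fin 3) → EuclideanSpace ℝ (Fin 3)) (_ : ContDiff ℝ 1 ξ ∧ HasCompactSupport ξ ∧ ∀ z, ξ z ∈ K), ENNReal.ofReal (∫ z in S, Literature.MathematicalPhysics.StatisticalMechanics.fieldDivergence ξ z)).toReal;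
    let ι : Set (EuclideanSpace ℝ (Fin 3)) → Set (EuclideanSpace ℝ (Fin 3)) → Set (EuclideanSpace ℝ (Fin 3)) → ℝ := fun K S₁ S₂ => (Per K S₁ + Per K S₂ - Per K (S₁ ∪ S₂)) / 2;
    let W : (EuclideanSpace ℝ (Fin 3) ≃ₗᵢ[ℝ] EuclideanSpace ℝ (Fin 3)) → Set (EuclideanSpace ℝ (Fin 3)) := fun A => {y | ∀ ν : EuclideanSpace ℝ (Fin 3), ⟪y, ν⟫_ℝ ≤ Φ (A.symm ν)};
    let Dsc : EuclideanSpace ℝ (Fin 3) → Set (EuclideanSpace ℝ (Fin 3)) := fun m => {y | ‖y‖ ≤ 1 ∧ ⟪y, m⟫_ℝ = 0};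
    let Tex : (n : ℕ) → (Fin n → Set (EuclideanSpace ℝ (Fin 3))) → (Fin n → (EuclideanSpace ℝ (Fin 3) ≃ₗᵢ[ℝ] EuclideanSpace ℝ (Fin 3))) → (Fin n → Fin n → ℝ) → (Fin n → Fin n → EuclideanSpace ℝ (Fin 3)) → Prop := fun n G A c m => (∀ f : Fin n, Literature.MathematicalPhysics.StatisticalMechanics.HasFinitePerimeter (G f) ∧ volume (G f) < ⊤) ∧ (∀ f g, f ≠ g → Disjoint (G f) (G g)) ∧ (∀ f g, f ≠ g → 0 ≤ c f g) ∧ (∀ f g, f ≠ g → ¬ CoAx (A f) (A g) → m f g = 0 ∧ 1 ≤ c f g) ∧ (∀ f g, f ≠ g → CoAx (A f) (A g) → A f '' Λ ≠ A g '' Λ → Ax (m f g) (A f) (A g) ∧ 1 / 2 ≤ c f g);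
    let En : (n : ℕ) → (Fin n → Set (EuclideanSpace ℝ (Fin 3))) → (Fin n → (EuclideanSpace ℝ (Fin 3) ≃ₗᵢ[ℝ] EuclideanSpace ℝ (Fin 3))) → (Fin n → Fin n → ℝ) → (Fin n → Fin n → EuclideanSpace ℝ (Fin 3)) → ℝ := fun n G A c m => ∑ f : Fin n, Per (W (A f)) (G f) - ∑ f, ∑ g, (if f = g then 0 else ι (W (A f)) (G f) (G g)) + ∑ f, ∑ g, (if f = g then 0 else c f g / 2 * ι (Dsc (m f g)) (G f) (G g));
    let Vol : (n : ℕ) → (Fin n → Set (EuclideanSpace ℝ (Fin 3))) → ℝ := fun n G => (volume (⋃ f : Fin n, G f)).toReal;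
    let Poly : Set (EuclideanSpace ℝ (Fin 3)) → Prop := fun S => ∃ (k : ℕ) (H : Fin k → Finset ((EuclideanSpace ℝ (Fin 3)) × ℝ)), S = ⋃ i, ⋂ p ∈ H i, {x | ⟪p.1, x⟫_ℝ < p.2};
    let TF : (n : ℕ) → (Fin n → (EuclideanSpace ℝ (Fin 3) ≃ₗᵢ[ℝ] EuclideanSpace ℝ (Fin 3))) → Prop := fun n A => ∀ f g : Fin n, f ≠ g → CoAx (A f) (A g) → A f '' Λ = A g '' Λ;
    ∀ (n : ℕ) (G : Fin n → Set (EuclideanSpace ℝ (Fin 3))) (A : Fin n → (EuclideanSpace ℝ (Fin 3) ≃ₗᵢ[ℝ] EuclideanSpace ℝ (Fin 3))) (c : Fin n → Fin n → ℝ) (m : Fin n → Fin n → EuclideanSpace ℝ (Fin 3)),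
      Tex n G A c m → (∀ f, Poly (G f)) → TF n A →
      (∀ f g h k : Fin n, A f '' Λ = A g '' Λ ∨ A f '' Λ = A h '' Λ ∨ A f '' Λ = A k '' Λ ∨
        A g '' Λ = A h '' Λ ∨ A g '' Λ = A k '' Λ ∨ A h '' Λ = A k '' Λ) →
      (∀ R : EuclideanSpace ℝ (Fin 3) ≃ₗᵢ[ℝ] EuclideanSpace ℝ (Fin 3), (27.8 : ℝ) ≤ (volume (W (LinearIsometryEquiv.refl ℝ (EuclideanSpace ℝ (Fin 3))) ∩ W R)).toReal) →
      6 * (2 : ℝ) ^ ((1 : ℝ) / 3) * (Real.sqrt 2 * Vol n G) ^ ((2 : ℝ) / 3) ≤ En n G A c m := by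
  intro Λ Brl Ax CoAx Φ Per ι W Dsc Tex En Vol Poly TF n G A c m hTex hPoly hTF hThree hOv
  -- a dominant class
  by_cases hdom : ∃ f₀ : Fin n, 17 / 20 * Vol n G ≤ (volume (⋃ g ∈ {g : Fin n | A g '' Λ = A f₀ '' Λ}, G g)).toReal
  · exact rung_dominantTwinFree n G A c m hTex hPoly hTF hdom
  -- at most two classes
  by_cases hTwo : ∀ f g h : Fin n, A f '' Λ = A g '' Λ ∨ A g '' Λ = A h '' Λ ∨ A f '' Λ = A h '' Λ
  · exact rung_twinFree_twoClasses_of_overlap n G A c m hTex hPoly hTF hTwo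
      (fun R => le_trans (by norm_num) (hOv R))
  -- three pairwise distinct lattices `a, b, d`
  push Not at hTwo
  obtain ⟨a, b, d, hab, hbd, had⟩ := hTwo
  set lat : Fin n → Set (EuclideanSpace ℝ (Fin 3)) := fun f => A f '' Λ with hlat
  have hcov : ∀ f, lat f = lat a ∨ lat f = lat b ∨ lat f = lat d := by
    intro f
    rcases hThree a b d f with h | h | h | h | h | h
    · exact absurd h hab
    · exact absurd h had
    · exact Or.inl h.symm
    · exact absurd h hbd
    · exact Or.inr (Or.inl h.symm)
    · exact Or.inr (Or.inr h.symm)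
  -- class volumes and the non-dominance bounds
  set v : Fin n → ℝ := fun t => (volume (⋃ f ∈ Finset.univ.filter (fun f => lat f = lat t), G f)).toReal with hv
  push Not at hdom
  have hset : ∀ t, (⋃ g ∈ {g : Fin n | lat g = lat t}, G g) = ⋃ f ∈ Finset.univ.filter (fun f => lat f = lat t), G f := by
    intro t; ext x
    simp only [Set.mem_iUnion, Set.mem_setOf_eq, Finset.mem_filter, Finset.mem_univ, true_and]
  have hdom' : ∀ t, v t ≤ 17 / 20 * Vol n G := fun t => by
    have h := hdom t; rw [hset t] at h; exact h.le
  have hVpos : 0 < Vol n G := by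
    rcases (show (0 : ℝ) ≤ Vol n G from ENNReal.toReal_nonneg).eq_or_lt with h | h
    · exfalso
      have h0 := hdom a
      rw [← h, mul_zero] at h0
      exact (not_le.2 h0) ENNReal.toReal_nonneg
    · exact h
  have key : ∀ x y z : Fin n, lat x ≠ lat y → lat y ≠ lat z → lat x ≠ lat z →
      (∀ f, lat f = lat x ∨ lat f = lat y ∨ lat f = lat z) → v z ≤ v y → v y ≤ v x →
      6 * (2 : ℝ) ^ ((1 : ℝ) / 3) * (Real.sqrt 2 * Vol n G) ^ ((2 : ℝ) / 3) ≤ En n G A c m :=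
    fun x y z hxy hyz hxz hc h1 h2 =>
      threeClass_core n G A c m x y z hTex hPoly hTF hxy hyz hxz hc h1 h2 (hdom' x) hVpos hOv
  -- sort the three class volumes
  rcases le_total (v b) (v a) with h1 | h1
  · rcases le_total (v d) (v b) with h2 | h2
    · exact key a b d hab hbd had hcov h2 h1
    · rcases le_total (v d) (v a) with h3 | h3
      · exact key a d b had hbd.symm hab (fun f => (hcov f).elim Or.inl fun h => h.elim (fun hb => Or.inr (Or.inr hb))
          fun hd => Or.inr (Or.inl hd)) h2 h3
      · exact key d a b had.symm hab hbd.symm (fun f => (hcov f).elim (fun ha => Or.inr (Or.inl ha)) fun h =>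
          h.elim (fun hb => Or.inr (Or.inr hb)) fun hd => Or.inl hd) h1 h3
  · rcases le_total (v d) (v b) with h2 | h2
    · rcases le_total (v d) (v a) with h3 | h3
      · exact key b a d (Ne.symm hab) had (hbd) (fun f => (hcov f).elim (fun ha => Or.inr (Or.inl ha)) fun h =>
          h.elim (fun hb => Or.inl hb) fun hd => Or.inr (Or.inr hd)) h3 h1
      · exact key b d a hbd had.symm (Ne.symm hab) (fun f => (hcov f).elim (fun ha => Or.inr (Or.inr ha)) fun h =>
          h.elim (fun hb => Or.inl hb) fun hd => Or.inr (Or.inl hd)) h3 h2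
    · exact key d b a hbd.symm (Ne.symm hab) had.symm (fun f => (hcov f).elim (fun ha => Or.inr (Or.inr ha)) fun h =>
        h.elim (fun hb => Or.inr (Or.inl hb)) fun hd => Or.inl hd) h1 h2

/-- The three-class middle-band rung with its computational hypothesis BY NAME (CH-P1′ = `WulffOverlap27_8`,
`…WulffOverlapHyps`). -/
theorem rung_twinFree_threeClasses_of_WulffOverlap27_8 (hCH : WulffOverlap27_8) :
    let Λ : Set (EuclideanSpace ℝ (Fin 3)) := Literature.MathematicalPhysics.StatisticalMechanics.fccStacking 1 (Real.sqrt (2 / 3));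
    let Brl : (ℤ → ℤ) → Set (EuclideanSpace ℝ (Fin 3)) := Literature.MathematicalPhysics.StatisticalMechanics.barlowStacking 1 (Real.sqrt (2 / 3));
    let Ax : EuclideanSpace ℝ (Fin 3) → (EuclideanSpace ℝ (Fin 3) ≃ₗᵢ[ℝ] EuclideanSpace ℝ (Fin 3)) → (EuclideanSpace ℝ (Fin 3) ≃ₗᵢ[ℝ] EuclideanSpace ℝ (Fin 3)) → Prop := fun m A B => ∃ (L : EuclideanSpace ℝ (Fin 3) ≃ₗᵢ[ℝ] EuclideanSpace ℝ (Fin 3)) (s₁ s₂ : EuclideanSpace ℝ (Fin 3)) (σ σ' : ℤ → ℤ), Literature.MathematicalPhysics.StatisticalMechanics.IsHaggSeq σ ∧ Literature.MathematicalPhysics.StatisticalMechanics.IsHaggSeq σ' ∧ L (EuclideanSpace.single (2 : Fin 3) (1 : ℝ)) = m ∧ A '' Λ ⊆ (fun q => L q + s₁) '' Brl σ ∧ B '' Λ ⊆ (fun q => L q + s₂) '' Brl σ';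
    let CoAx : (EuclideanSpace ℝ (Fin 3) ≃ₗᵢ[ℝ] EuclideanSpace ℝ (Fin 3)) → (EuclideanSpace ℝ (Fin 3) ≃ₗᵢ[ℝ] EuclideanSpace ℝ (Fin 3)) → Prop := fun A B => ∃ m, Ax m A B;
    let Φ : EuclideanSpace ℝ (Fin 3) → ℝ := fun ν => Real.sqrt 2 / 4 * ∑ᶠ w ∈ {w ∈ Λ | ‖w‖ = 1}, |⟪w, ν⟫_ℝ|;
    let Per : Set (EuclideanSpace ℝ (Fin 3)) → Set (EuclideanSpace ℝ (Fin 3)) → ℝ := fun K S => (⨆ (ξ : EuclideanSpace ℝ (Fin 3) → EuclideanSpace ℝ (Fin 3)) (_ : ContDiff ℝ 1 ξ ∧ HasCompactSupport ξ ∧ ∀ z, ξ z ∈ K), ENNReal.ofReal (∫ z in S, Literature.MathematicalPhysics.StatisticalMechanics.fieldDivergence ξ z)).toReal;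
    let ι : Set (EuclideanSpace ℝ (Fin 3)) → Set (EuclideanSpace ℝ (Fin 3)) → Set (EuclideanSpace ℝ (Fin 3)) → ℝ := fun K S₁ S₂ => (Per K S₁ + Per K S₂ - Per K (S₁ ∪ S₂)) / 2;
    let W : (EuclideanSpace ℝ (Fin 3) ≃ₗᵢ[ℝ] EuclideanSpace ℝ (Fin 3)) → Set (EuclideanSpace ℝ (Fin 3)) := fun A => {y | ∀ ν : EuclideanSpace ℝ (Fin 3), ⟪y, ν⟫_ℝ ≤ Φ (A.symm ν)};
    let Dsc : EuclideanSpace ℝ (Fin 3) → Set (EuclideanSpace ℝ (Fin 3)) := fun m => {y | ‖y‖ ≤ 1 ∧ ⟪y, m⟫_ℝ = 0};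
    let Tex : (n : ℕ) → (Fin n → Set (EuclideanSpace ℝ (Fin 3))) → (Fin n → (EuclideanSpace ℝ (Fin 3) ≃ₗᵢ[ℝ] EuclideanSpace ℝ (Fin 3))) → (Fin n → Fin n → ℝ) → (Fin n → Fin n → EuclideanSpace ℝ (Fin 3)) → Prop := fun n G A c m => (∀ f : Fin n, Literature.MathematicalPhysics.StatisticalMechanics.HasFinitePerimeter (G f) ∧ volume (G f) < ⊤) ∧ (∀ f g, f ≠ g → Disjoint (G f) (G g)) ∧ (∀ f g, f ≠ g → 0 ≤ c f g) ∧ (∀ f g, f ≠ g → ¬ CoAx (A f) (A g) → m f g = 0 ∧ 1 ≤ c f g) ∧ (∀ f g, f ≠ g → CoAx (A f) (A g) → A f '' Λ ≠ A g '' Λ → Ax (m f g) (A f) (A g) ∧ 1 / 2 ≤ c f g);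
    let En : (n : ℕ) → (Fin n → Set (EuclideanSpace ℝ (Fin 3))) → (Fin n → (EuclideanSpace ℝ (Fin 3) ≃ₗᵢ[ℝ] EuclideanSpace ℝ (Fin 3))) → (Fin n → Fin n → ℝ) → (Fin n → Fin n → EuclideanSpace ℝ (Fin 3)) → ℝ := fun n G A c m => ∑ f : Fin n, Per (W (A f)) (G f) - ∑ f, ∑ g, (if f = g then 0 else ι (W (A f)) (G f) (G g)) + ∑ f, ∑ g, (if f = g then 0 else c f g / 2 * ι (Dsc (m f g)) (G f) (G g));
    let Vol : (n : ℕ) → (Fin n → Set (EuclideanSpace ℝ (Fin 3))) → ℝ := fun n G => (volume (⋃ f : Fin n, G f)).toReal;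
    let Poly : Set (EuclideanSpace ℝ (Fin 3)) → Prop := fun S => ∃ (k : ℕ) (H : Fin k → Finset ((EuclideanSpace ℝ (Fin 3)) × ℝ)), S = ⋃ i, ⋂ p ∈ H i, {x | ⟪p.1, x⟫_ℝ < p.2};
    let TF : (n : ℕ) → (Fin n → (EuclideanSpace ℝ (Fin 3) ≃ₗᵢ[ℝ] EuclideanSpace ℝ (Fin 3))) → Prop := fun n A => ∀ f g : Fin n, f ≠ g → CoAx (A f) (A g) → A f '' Λ = A g '' Λ;
    ∀ (n : ℕ) (G : Fin n → Set (EuclideanSpace ℝ (Fin 3))) (A : Fin n → (EuclideanSpace ℝ (Fin 3) ≃ₗᵢ[ℝ] EuclideanSpace ℝ (Fin 3))) (c : Fin n → Fin n → ℝ) (m : Fin n → Fin n → EuclideanSpace ℝ (Fin 3)),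
      Tex n G A c m → (∀ f, Poly (G f)) → TF n A →
      (∀ f g h k : Fin n, A f '' Λ = A g '' Λ ∨ A f '' Λ = A h '' Λ ∨ A f '' Λ = A k '' Λ ∨
        A g '' Λ = A h '' Λ ∨ A g '' Λ = A k '' Λ ∨ A h '' Λ = A k '' Λ) →
      6 * (2 : ℝ) ^ ((1 : ℝ) / 3) * (Real.sqrt 2 * Vol n G) ^ ((2 : ℝ) / 3) ≤ En n G A c m := by
  intro Λ Brl Ax CoAx Φ Per ι W Dsc Tex En Vol Poly TF n G A c m hTex hPoly hTF hThree
  exact rung_twinFree_threeClasses_of_overlap n G A c m hTex hPoly hTF hThree hCH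

end Summit.Ventures.Crystal3D.Cruxes.PolycrystalWulffBound.PolyDensity

end
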